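import Literature.Computability.Cryptography.RegevReductionStepRatio
import Literature.Computability.Cryptography.RegevCVPOracleFn
import Literature.Algebra.EuclideanLattices.RegevSmoothingLowerBound
import HarnessLib

/-!
# Regev 2009, Lemma 3.3 in machine form = Lemma 3.4 (the `CVP` family) + Lemma 3.14 (the quantum step
# family): the residual A_exact SPLIT along Regev's own lemma boundary, with the assembly PROVED

Topic `Computability/Cryptography` (family `pqc`), sequel of `RegevReductionStepRatio.lean` (the named
fact `regev2009_lemma_3_3_stepExact q α` = residual A_exact, the ONE remaining named residual of the
tree's formalisation of Regev's Theorem 1.1: `regev_lwe_to_sivp_quantum_holds_of_exact`,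
`regev_lwe_to_gapSVP_quantum_holds_of_exact`) and of `RegevCVPOracleFn.lean` (the query format
`Regev2009.CVPOracle.query` and the answer `Regev2009.CVPOracle.answerTable` shared by the two halves of
the iterative step). O. Regev, *On lattices, learning with errors, random linear codes, and
cryptography*, J. ACM 56 (2009), art. 34 (author's version arXiv:2401.03703, whose page numbers are
quoted), proof of Lemma 3.3 (p. 15): "The algorithm consists of two main parts. The first part is shown
in Lemma 3.4. There, we describe a (classical) algorithm that using `W` and the samples from `D_{L,r}`,
solves `CVP_{L*, αp/(√2 r)}`. The second part is shown in Lemma 3.14. There, we describe a quantum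
algorithm that, given an oracle that solves `CVP_{L*, αp/(√2 r)}`, outputs a sample from
`D_{L, r√n/(αp)}`. This is the only quantum component in this paper. We note that the condition in
Lemma 3.14 is satisfied since by Claim 2.13, `αp/(√2 r) ≤ 1/η_ε(L) ≤ λ₁(L*)/2`."

THIS FILE types the two parts as machine-level named facts over the tree's uniform quantum circuit
families and PROVES that together they give A_exact:

* `regev2009_lemma_3_4_cvpFamily q α` (NAMED FACT A_cvp = Lemma 3.4, "first part of the iterative
  step", in machine form): from the `LWE` solver `W` of Theorem 3.1, a uniform family `R` (classical
  with the `LWE` oracle substituted — Regev: "an efficient algorithm that … solves `CVP_{L*,αp/(√2r)}`"),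
  a batch-size polynomial `p_N` (Regev's `n^c` samples) and a negligible `ν` such that, eventually in
  `n`, for every nonsingular `I` of dimension `n` and rational `ρ > √2 q η_ε(L(I))`, every level `k`
  and every ADMISSIBLE in-range query datum `c` (`Regev2009.CVPOracle.Admissible`: the dyadic dual
  point `point I c ∈ L(I)*/2^{ℓ_R}` lies within `αq/(√2ρ)` of `L(I)*`, and the requested answer width
  is at most the grid exponent, `b_c ≤ ℓ_R`, so that the answer fits on the wires), the probability that `R`, run
  on the query string `CVPOracle.query I ρ k (encBatch b) c` carrying a batch `b ∼ D_{L(I),ρ}^{p_N(n)}`,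
  does NOT write the answer table `CVPOracle.answerTable I c` (the coefficient vector of the closest
  dual lattice vector) on its first wires is at most `ν(n)` ON AVERAGE OVER THE BATCH
  (`Regev2009.CVPOracle.failProb`; Regev's note after Lemma 3.3: correctness holds for all but a
  negligible fraction of the sample tuples, uniformly in the point).
* `regev2009_lemma_3_14_stepFamily q α` (NAMED FACT A_q14 = Lemma 3.14, "second part of the iterative
  step", in machine form, with the oracle-substitution bound of Bennett–Bernstein–Brassard–Vazirani
  made explicit): for EVERY uniform family `R` (a candidate `CVP` solver, no promise) and all
  polynomials `p_N, L_req`, one uniform family `S` — the step machine of A_exact with `R` substituted for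
  its `CVP` oracle — with A_exact's clauses (CODE⁺) and (PASS₁) verbatim and, at a stage `k + 1 ≤ 3n` with
  `0 < ρ_k` and decoding distance `d_k = αq/(√2ρ_k) < λ₁(L(I)*)/2` (the hypothesis of Lemma 3.14), a
  query-data law `w` (depending on the instance, the level and `n` only — the sampler's quantum state
  "`Σ_{x ∈ L*/R} ρ(x)|x⟩`" does not depend on the batch) such that every copy's output is within
  `C·√(E_{c∼w}[1{c admissible}·fail_R(b,c)]) + ν'(n)` of `D_{L(I), ρ_k√n/(αq)}` in total variation
  (`Regev2009.CVPOracle.weightedFail`; `C` a constant, `ν'` negligible). This is the shape of the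
  bound the tree PROVES for oracle substitution: the weighted form of BBBV 1997, Thm. 4.14, for the
  function-valued tidy block, `TidyBlockFn.normSq_tidyCirc_sub_idealFn_le` (`‖Tψ − U_f ψ‖₂² ≤
  4 Σ_q errFn(q)·w_ψ(q)`, `QuantumComplexity/TidyBlockFn.lean`; `errFn` is `failProb` here), summed
  along the ideal trajectory (BBBV Thm. 3.3; `OracleImpl.l2Norm_substGates_tidy_sub_le`,
  `QuantumComplexity/OracleSubstitutionWeighted.lean`) over the TWO calls of the sampler (recover `x`,
  then uncompute the answer register), both with the same ideal query weights `w`; the mass of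
  inadmissible queries (Gaussian points of norm `≥ √n`, Regev's Lemma 2.5), the state-preparation and
  discretisation errors of Lemma 3.12 / Claim 3.13 and Babai rounding are inside `ν'`.
* `regev2009_lemma_3_3_stepExact_of_cvp_of_step : A_cvp → A_q14 → A_exact` — PROVED: take `R, p_N, ν` of
  A_cvp and the `S` of A_q14 for this `R`; Regev's one-line check `d_k < λ₁(L*)/2`
  (`Regev2009.decodingDist_lt_half_minNorm_dual`, from the tree's Claim 2.13
  `Regev2009.sqrt_log_div_minNorm_dual_le_smoothingParameter`, `α < 1` and `ε(n) ≤ e^{-π}` eventually);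
  the per-batch error `F₁(b) = |C|·√(weightedFail(b)) + |ν'(n)|`; and
  `E_b[min 1 F₁(b)] ≤ |C|·√(ν(n)) + |ν'(n)|` by exchanging the two expectations (Fubini in `ℝ≥0∞`,
  `Regev2009.CVPOracle.tsum_mul_weightedFail_le`) and Jensen's inequality for the square root in the
  elementary form `√g ≤ g/(2t) + t/2` (`Regev2009.tsum_toReal_mul_sqrt_le`); `√ν` is negligible
  (`Regev2009.isNegligible_sqrt_abs`).
* Consequences (by the proved chain of `RegevReductionStepRatio.lean`, `RegevReductionOneSampleStage.lean`,
  `RegevReductionResiduals.lean`): `regev2009_lemma_3_3_stepMachine_of_cvp_of_step` (A_step),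
  `regev_lwe_to_sivp_quantum_holds_of_cvp_of_step` (`pqc.S19` as filed) and
  `regev_lwe_to_gapSVP_quantum_holds_of_cvp_of_step` (the `GapSVP` form) from A_cvp and A_q14 alone.

RESIDUAL HYPOTHESES after this file: A_cvp (classical: Lemma 3.4 = Lemmas 3.5, 3.7, 3.11 around the `LWE`
oracle `W`, as one uniform family with `W` substituted, BBBV Thm. 4.14) and A_q14 (quantum: Lemma 3.14's
sampler — Lemma 3.12 state preparation, the tree's `QPart.law_bound_of_basis`
(`Algebra/EuclideanLattices/RegevQuantumPartLaw.lean`) for its law, the classical blocks of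
`RegevSamplerClassical.lean` — as one uniform family with `R` substituted through the tidy block of
`TidyBlockFn.lean` and analysed by `TidyBlockFn.normSq_tidyCirc_sub_idealFn_le` /
`OracleImpl.l2Norm_substGates_tidy_sub_le`, plus the classical dressing of the stage machine: level
radius, batch canonicalisation, clipping, pass-through). VALUE = two typed
residuals replacing one along the classical/quantum boundary of the printed proof, and a machine-checked
assembly — NOT a proof of either part, and not progress on any open problem (Regev's theorem is KNOWN).

## Faithfulness notes

* The query of the sampler is CANONICAL: it carries the batch code `encBatch b` read back and re-encoded
  (no padding, no copy index), so that `R`'s failure is a function of the batch — A_exact's per-batch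
  error functional `F₁(b)` must not depend on the padding of the window or on the copy index.
* The law `w` of the query data is quantified BEFORE the batch (`∃ w, ∀ b pad j`): this is what lets the
  average over the batch (A_cvp) be taken inside the average over the query (A_q14). It holds for
  Regev's sampler, whose registers before the oracle call hold a state determined by `(L(I)*, R, d)`.
* A_cvp asks `R` to answer only at DYADIC dual points `Σ (s_j/2^{ℓ_R}) b^∨_j` (all the sampler asks),
  in the fixed-width table format of `RegevCVPOracleFn.lean`, and only for requested answer widths
  `b_c ≤ ℓ_R` (the width clause of `CVPOracle.Admissible`: the `n·b_c`-bit answer is then at most as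
  long as the query, so a polynomial-size family CAN print it — with `b_c` unbounded, written in binary
  in the query, the per-point demand would be unsatisfiable and A_cvp vacuously false; the sampler of
  Lemma 3.14 loses nothing, since it may take its grid exponent `ℓ_R` as large as the width it needs);
  Regev's Lemma 3.4 answers at every real point within `αp/(√2r)` of `L*`.
* Nothing here restates `pqc.S19` or alters A_exact; the junk conventions are those of A_exact.

## References

* O. Regev, *On lattices, learning with errors, random linear codes, and cryptography*, J. ACM 56 (2009),
  art. 34; author's version arXiv:2401.03703: Lemma 3.3 and its proof (p. 15), Lemma 3.4 (p. 15),
  Lemma 3.14 (p. 20), Claim 2.13 (p. 14), Lemma 2.5. [Regev2009] [RegevLWE2009]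
* C. H. Bennett, E. Bernstein, G. Brassard, U. Vazirani, *Strengths and weaknesses of quantum computing*,
  SIAM J. Comput. 26 (1997), Thm. 3.1, Thm. 3.3 (hybrid argument), Thm. 4.14 (tidy subroutines).
  [BennettBernsteinBrassardVazirani1997]
* E. Bernstein, U. Vazirani, *Quantum complexity theory*, SIAM J. Comput. 26 (1997), §8.
  [BernsteinVazirani1997]
-/

noncomputable section

namespace Literature.Computability.Cryptography

open Filter _root_.Computability Literature.Computability.Complexity
  Literature.Algebra.EuclideanLattices Literature.Computability.QuantumComplexity
  Literature.Computability.Cryptography.LWE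
open scoped ENNReal

namespace Regev2009

/-! ### The level radius as a rational -/

/-- **The level radius as a RATIONAL**: `ρ_k = θ^{L-k} r` for rational `θ, r` (the instance code handed
to the `CVP` family carries it exactly). [cite: Regev2009, proof of Theorem 3.1 (p. 15): `r_i = r (αp/√n)^i`] -/
def levelRadiusQ (θ : ℚ) (L : ℕ) (r : ℚ) (k : ℕ) : ℚ := θ ^ (L - k) * r

/-- The rational level radius casts to `levelRadius`. [folklore] -/
theorem cast_levelRadiusQ (θ : ℚ) (L : ℕ) (r : ℚ) (k : ℕ) :
    ((levelRadiusQ θ L r k : ℚ) : ℝ) = levelRadius (θ : ℝ) L (r : ℝ) k := by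
  rw [levelRadiusQ, levelRadius, Rat.cast_mul, Rat.cast_pow]

namespace CVPOracle

/-! ### Failure of a candidate `CVP` family on a query; admissible query data; the weighted failure -/

/-- **The failure probability of a family `R` on the query of the datum `c`** at `(I, ρ, k, y)`: the
probability that the measured wires of `R` run on `query I ρ k y c` do NOT start with the answer table
`answerTable I c`. [cite: Regev2009, Lemma 3.4 ("solves CVP_{L*, αp/(√2 r)}": outputs the coefficient vector of the closest vector)] -/
def failProb (R : UniformQCircuitFamily) (I : LatticeInstance) (ρ : ℚ) (k : ℕ) (y : List Bool)
    (c : QData I.n) : ℝ :=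
  1 - R.kernelProb (query I ρ k y c) {s | answerTable I c <+: s}

/-- `0 ≤ failProb`. [folklore] -/
theorem failProb_nonneg (R : UniformQCircuitFamily) (I : LatticeInstance) (ρ : ℚ) (k : ℕ) (y : List Bool)
    (c : QData I.n) : 0 ≤ failProb R I ρ k y c :=
  sub_nonneg.2 (R.kernelProb_le_one _ _)

/-- `failProb ≤ 1`. [folklore] -/
theorem failProb_le_one (R : UniformQCircuitFamily) (I : LatticeInstance) (ρ : ℚ) (k : ℕ) (y : List Bool)
    (c : QData I.n) : failProb R I ρ k y c ≤ 1 := by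
  have h : 0 ≤ R.kernelProb (query I ρ k y c) {s | answerTable I c <+: s} := by
    rw [UniformQCircuitFamily.kernelProb_eq]
    exact ENNReal.toReal_nonneg
  unfold failProb
  linarith

/-- **Admissible query data at decoding distance `d`**: the residues are in range (`s_j < 2^{ℓ_R}`, so
that the datum is determined by its query string), the requested answer width `b_c = c.2.2` is at most
the grid exponent `ℓ_R = c.2.1` (so that the `n·b_c`-bit answer table is no longer than the `n·ℓ_R`-bit
residue table inside the query string, hence printable by a polynomial-size family on the wires it is
run on — without this clause no uniform family could serve the data with `b_c` exponential in the query
length, `b_c` being written in binary; it costs the sampler nothing, which may take its grid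
`R = 2^{ℓ_R} ≥ 2^{3n}λ_n(L*)` "a large enough integer", Lemma 3.14), and the query point lies within `d`
of the dual lattice `L(I)*` — the promise of `CVP_{L*,d}`.
[cite: Regev2009, Lemma 3.4 ("given any point x within distance d of L") and Lemma 3.14 (proof, "Let R ≥ 2^{3n}λ_n(L*) be a large enough integer")] -/
def Admissible (I : LatticeInstance) (d : ℝ) (c : QData I.n) : Prop :=
  InRange c ∧ c.2.2 ≤ c.2.1 ∧ ∃ v ∈ dualLattice I.lattice, ‖point I c - v‖ ≤ d

/-- **The weighted failure of `R` under a law `w` of the query data** (in `ℝ≥0∞`):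
`E_{c∼w}[1{c admissible at distance d} · failProb R … c]` — the quantity through which the hybrid
argument bounds the effect of substituting `R` for the ideal `CVP_{L*,d}` oracle (inadmissible queries
are not charged to `R`). [cite: BennettBernsteinBrassardVazirani1997, Thm. 3.3 (hybrid argument)] -/
def weightedFail (R : UniformQCircuitFamily) (I : LatticeInstance) (ρ : ℚ) (k : ℕ) (y : List Bool)
    (d : ℝ) (w : PMF (QData I.n)) : ℝ≥0∞ :=
  ∑' c, w c * ENNReal.ofReal ({c | Admissible I d c}.indicator (failProb R I ρ k y) c)

/-- The charged failure of one datum is at most `1`. [folklore] -/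
theorem ofReal_indicator_failProb_le_one (R : UniformQCircuitFamily) (I : LatticeInstance) (ρ : ℚ) (k : ℕ)
    (y : List Bool) (d : ℝ) (c : QData I.n) :
    ENNReal.ofReal ({c | Admissible I d c}.indicator (failProb R I ρ k y) c) ≤ 1 := by
  rw [← ENNReal.ofReal_one]
  refine ENNReal.ofReal_le_ofReal ?_
  by_cases hc : c ∈ {c | Admissible I d c}
  · rw [Set.indicator_of_mem hc]
    exact failProb_le_one R I ρ k y c
  · rw [Set.indicator_of_notMem hc]
    exact zero_le_one

/-- **The weighted failure is at most `1`.** [folklore] -/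
theorem weightedFail_le_one (R : UniformQCircuitFamily) (I : LatticeInstance) (ρ : ℚ) (k : ℕ) (y : List Bool)
    (d : ℝ) (w : PMF (QData I.n)) : weightedFail R I ρ k y d w ≤ 1 := by
  unfold weightedFail
  calc ∑' c, w c * ENNReal.ofReal ({c | Admissible I d c}.indicator (failProb R I ρ k y) c)
      ≤ ∑' c, w c * 1 := ENNReal.tsum_le_tsum fun c =>
        mul_le_mul' le_rfl (ofReal_indicator_failProb_le_one R I ρ k y d c)
    _ = 1 := by rw [ENNReal.tsum_mul_right, PMF.tsum_coe, one_mul]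

/-- **Exchanging the two averages** (Fubini in `ℝ≥0∞`): if, for every admissible datum `c`, the failure
of `R` averaged over the batch `b ∼ p` is at most `v`, then the weighted failure under any law `w` of
the data, averaged over the batch, is at most `v`. [folklore] -/
theorem tsum_mul_weightedFail_le (R : UniformQCircuitFamily) (I : LatticeInstance) (ρ : ℚ) (k N : ℕ)
    (d : ℝ) (p : PMF (Fin N → Fin I.n → ℤ)) (w : PMF (QData I.n)) {v : ℝ≥0∞}
    (h : ∀ c, Admissible I d c →
      ∑' b, p b * ENNReal.ofReal (failProb R I ρ k (encBatch I.n N b) c) ≤ v) :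
    ∑' b, p b * weightedFail R I ρ k (encBatch I.n N b) d w ≤ v := by
  have hc : ∀ c, ∑' b, p b * ENNReal.ofReal ({c | Admissible I d c}.indicator
      (failProb R I ρ k (encBatch I.n N b)) c) ≤ v := fun c => by
    by_cases hc : c ∈ {c | Admissible I d c}
    · simp_rw [Set.indicator_of_mem hc]
      exact h c hc
    · simp_rw [Set.indicator_of_notMem hc, ENNReal.ofReal_zero, mul_zero, tsum_zero]
      exact bot_le
  unfold weightedFail
  calc ∑' b, p b * ∑' c, w c * ENNReal.ofReal ({c | Admissible I d c}.indicator
          (failProb R I ρ k (encBatch I.n N b)) c)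
      = ∑' b, ∑' c, w c * (p b * ENNReal.ofReal ({c | Admissible I d c}.indicator
          (failProb R I ρ k (encBatch I.n N b)) c)) := by
        refine tsum_congr fun b => ?_
        rw [← ENNReal.tsum_mul_left]
        exact tsum_congr fun c => by ring
    _ = ∑' c, ∑' b, w c * (p b * ENNReal.ofReal ({c | Admissible I d c}.indicator
          (failProb R I ρ k (encBatch I.n N b)) c)) := ENNReal.tsum_comm
    _ = ∑' c, w c * ∑' b, p b * ENNReal.ofReal ({c | Admissible I d c}.indicator
          (failProb R I ρ k (encBatch I.n N b)) c) :=
        tsum_congr fun c => ENNReal.tsum_mul_left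
    _ ≤ ∑' c, w c * v := ENNReal.tsum_le_tsum fun c => mul_le_mul' le_rfl (hc c)
    _ = v := by rw [ENNReal.tsum_mul_right, PMF.tsum_coe, one_mul]

end CVPOracle

/-! ### Analytic bricks of the assembly -/

/-- **Regev's check of the hypothesis of Lemma 3.14** (proof of Lemma 3.3, p. 15: "by Claim 2.13,
`αp/(√2 r) ≤ 1/η_ε(L) ≤ λ₁(L*)/2`"): for `0 < α < 1`, `0 < q`, `0 < ε ≤ e^{-π}` and
`ρ > √2 q η_ε(L(I))`, the decoding distance `αq/(√2ρ)` is below `λ₁(L(I)*)/2`.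
[cite: Regev2009, Lemma 3.3 (proof, p. 15), Claim 2.13] -/
theorem decodingDist_lt_half_minNorm_dual (I : LatticeInstance) (hI : I.IsNonsingular) (hn : 0 < I.n)
    {ε : ℝ} (hε : 0 < ε) (hεπ : ε ≤ Real.exp (-Real.pi)) {av qv ρ : ℝ} (ha0 : 0 < av) (ha1 : av < 1)
    (hq : 0 < qv) (hρ : Real.sqrt 2 * qv * smoothingParameter I.lattice ε < ρ) :
    av * qv / (Real.sqrt 2 * ρ) < minNorm (dualLattice I.lattice) / 2 := by
  haveI := LatticeInstance.isZLattice_of_isNonsingular hI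
  haveI : Nontrivial (EuclideanSpace ℝ (Fin I.n)) :=
    Module.nontrivial_of_finrank_pos (R := ℝ) (by rw [finrank_euclideanSpace_fin]; exact hn)
  set η : ℝ := smoothingParameter I.lattice ε
  set l₁ : ℝ := minNorm (dualLattice I.lattice)
  have hl : 0 < l₁ := minNorm_pos_of_ne_bot _ (dualLattice_ne_bot I.lattice)
  have hclaim : Real.sqrt (Real.log (1 / ε) / Real.pi) / l₁ ≤ η :=
    Literature.Algebra.EuclideanLattices.Regev2009.sqrt_log_div_minNorm_dual_le_smoothingParameter I.lattice hε
  -- `ε ≤ e^{-π}` gives `√(ln(1/ε)/π) ≥ 1`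
  have hlog : Real.pi ≤ Real.log (1 / ε) := by
    rw [Real.le_log_iff_exp_le (by positivity), le_div_iff₀ hε]
    calc Real.exp Real.pi * ε ≤ Real.exp Real.pi * Real.exp (-Real.pi) :=
          mul_le_mul_of_nonneg_left hεπ (Real.exp_pos _).le
      _ = 1 := by rw [← Real.exp_add, add_neg_cancel, Real.exp_zero]
  have hsq : 1 ≤ Real.sqrt (Real.log (1 / ε) / Real.pi) := by
    have h := Real.sqrt_le_sqrt ((one_le_div Real.pi_pos).2 hlog)
    rwa [Real.sqrt_one] at h
  have h1 : 1 / l₁ ≤ η := le_trans (div_le_div_of_nonneg_right hsq hl.le) hclaim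
  have hη : 0 < η := lt_of_lt_of_le (by positivity) h1
  have hiη : 1 / η ≤ l₁ := (one_div_le hη hl).2 h1
  have hden : 0 < Real.sqrt 2 * qv * η := by positivity
  have hρ0 : 0 < ρ := hden.trans hρ
  have hs2 : Real.sqrt 2 * Real.sqrt 2 = 2 := Real.mul_self_sqrt (by norm_num)
  calc av * qv / (Real.sqrt 2 * ρ) < av * qv / (Real.sqrt 2 * (Real.sqrt 2 * qv * η)) := by
        apply div_lt_div_of_pos_left (by positivity) (by positivity)
        exact mul_lt_mul_of_pos_left hρ (by positivity)
    _ = av / (2 * η) := by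
        rw [show Real.sqrt 2 * (Real.sqrt 2 * qv * η) = (Real.sqrt 2 * Real.sqrt 2) * qv * η by ring, hs2]
        field_simp
    _ < 1 / (2 * η) := div_lt_div_of_pos_right (by linarith) (by positivity)
    _ = (1 / η) / 2 := by ring
    _ ≤ l₁ / 2 := by linarith

/-- **Jensen's inequality for the square root against a probability mass function**, in the elementary
form used by the assembly: if `E_{b∼p}[G(b)] ≤ v` (`G ≤ 1`, in `ℝ≥0∞`) then `E_{b∼p}[√G(b)] ≤ √v`
(pointwise `√g ≤ g/(2t) + t/2` at `t = √v`). [folklore] -/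
theorem tsum_toReal_mul_sqrt_le {β : Type*} (p : PMF β) (G : β → ℝ≥0∞) (hG : ∀ b, G b ≤ 1) {v : ℝ}
    (hv : 0 ≤ v) (h : ∑' b, p b * G b ≤ ENNReal.ofReal v) :
    ∑' b, (p b).toReal * Real.sqrt (G b).toReal ≤ Real.sqrt v := by
  have hGtop : ∀ b, G b ≠ ∞ := fun b => ne_top_of_le_ne_top ENNReal.one_ne_top (hG b)
  have hG1 : ∀ b, (G b).toReal ≤ 1 := fun b => by
    have := ENNReal.toReal_mono ENNReal.one_ne_top (hG b)
    rwa [ENNReal.toReal_one] at this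
  have hsp : Summable fun b => (p b).toReal := ENNReal.summable_toReal p.tsum_coe_ne_top
  have hp1 : ∑' b, (p b).toReal = 1 := by
    rw [← ENNReal.tsum_toReal_eq fun b => p.apply_ne_top b, PMF.tsum_coe, ENNReal.toReal_one]
  have hs1 : Summable fun b => (p b).toReal * Real.sqrt (G b).toReal :=
    hsp.of_nonneg_of_le (fun b => mul_nonneg ENNReal.toReal_nonneg (Real.sqrt_nonneg _)) fun b => by
      have : Real.sqrt (G b).toReal ≤ 1 := by
        rw [← Real.sqrt_one]; exact Real.sqrt_le_sqrt (hG1 b)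
      simpa using mul_le_mul_of_nonneg_left this (ENNReal.toReal_nonneg (a := p b))
  have hs2 : Summable fun b => (p b).toReal * (G b).toReal :=
    hsp.of_nonneg_of_le (fun b => mul_nonneg ENNReal.toReal_nonneg ENNReal.toReal_nonneg) fun b => by
      simpa using mul_le_mul_of_nonneg_left (hG1 b) (ENNReal.toReal_nonneg (a := p b))
  have hE : ∑' b, (p b).toReal * (G b).toReal ≤ v := by
    have e : ∑' b, (p b).toReal * (G b).toReal = (∑' b, p b * G b).toReal := by
      rw [ENNReal.tsum_toReal_eq fun b => ENNReal.mul_ne_top (p.apply_ne_top b) (hGtop b)]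
      exact tsum_congr fun b => ENNReal.toReal_mul.symm
    rw [e]
    exact ENNReal.toReal_le_of_le_ofReal hv h
  rcases hv.eq_or_lt with hv0 | hvpos
  · -- `v = 0`: every term vanishes
    subst hv0
    have hzero : ∑' b, p b * G b = 0 := le_antisymm (by rwa [ENNReal.ofReal_zero] at h) bot_le
    rw [ENNReal.tsum_eq_zero] at hzero
    have ht : ∀ b, (p b).toReal * Real.sqrt (G b).toReal = 0 := fun b => by
      rcases mul_eq_zero.1 (hzero b) with h0 | h0
      · rw [h0, ENNReal.toReal_zero, zero_mul]
      · rw [h0, ENNReal.toReal_zero, Real.sqrt_zero, mul_zero]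
    rw [tsum_congr ht, tsum_zero, Real.sqrt_zero]
  · set t : ℝ := Real.sqrt v with htdef
    have ht : 0 < t := Real.sqrt_pos.2 hvpos
    have h2t : 0 < 2 * t := by positivity
    have hamgm : ∀ g : ℝ, 0 ≤ g → Real.sqrt g ≤ g / (2 * t) + t / 2 := fun g hg => by
      rw [div_add' _ _ _ h2t.ne', le_div_iff₀ h2t]
      nlinarith [sq_nonneg (Real.sqrt g - t), Real.sq_sqrt hg, Real.sqrt_nonneg g]
    have hs3 : Summable fun b => (p b).toReal * (G b).toReal / (2 * t) + (p b).toReal * (t / 2) :=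
      (hs2.div_const _).add (hsp.mul_right _)
    calc ∑' b, (p b).toReal * Real.sqrt (G b).toReal
        ≤ ∑' b, ((p b).toReal * (G b).toReal / (2 * t) + (p b).toReal * (t / 2)) := by
          refine hs1.tsum_le_tsum (fun b => ?_) hs3
          have := mul_le_mul_of_nonneg_left (hamgm _ (ENNReal.toReal_nonneg (a := G b)))
            (ENNReal.toReal_nonneg (a := p b))
          calc (p b).toReal * Real.sqrt (G b).toReal ≤ (p b).toReal * ((G b).toReal / (2 * t) + t / 2) := this
            _ = (p b).toReal * (G b).toReal / (2 * t) + (p b).toReal * (t / 2) := by ring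
      _ = (∑' b, (p b).toReal * (G b).toReal) / (2 * t) + (∑' b, (p b).toReal) * (t / 2) := by
          rw [(hs2.div_const _).tsum_add (hsp.mul_right _), tsum_div_const, tsum_mul_right]
      _ ≤ v / (2 * t) + 1 * (t / 2) := by
          rw [hp1]
          exact add_le_add (div_le_div_of_nonneg_right hE h2t.le) le_rfl
      _ = Real.sqrt v := by
          rw [htdef, one_mul, mul_comm (2 : ℝ), ← div_div, Real.div_sqrt]
          ring

/-- **The square root of a negligible function is negligible** (`n^c √|ν(n)| = √(n^{2c} |ν(n)|) → 0`).
[folklore] -/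
theorem isNegligible_sqrt_abs {ν : ℕ → ℝ} (hν : IsNegligible ν) : IsNegligible fun n => Real.sqrt |ν n| := by
  intro c
  have h := ((hν (2 * c)).abs).sqrt
  rw [abs_zero, Real.sqrt_zero] at h
  refine h.congr fun n => ?_
  have hn : (0 : ℝ) ≤ (n : ℝ) ^ c := pow_nonneg (Nat.cast_nonneg n) c
  show Real.sqrt |(n : ℝ) ^ (2 * c) * ν n| = (n : ℝ) ^ c * Real.sqrt |ν n|
  rw [abs_mul, pow_mul', abs_of_nonneg (pow_nonneg hn 2), Real.sqrt_mul (pow_nonneg hn 2), Real.sqrt_sq hn]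

end Regev2009

/-! ### The two residuals and the assembly -/

section Split

variable (q : ℕ → ℕ) [∀ n, NeZero (q n)] (α : ℕ → ℝ)

/-- NAMED FACT (residual A_cvp) — **Regev 2009, Lemma 3.4 (first part of the iterative step) in machine
form.** "Let `ε(n)` be negligible, `p(n) ≥ 2`, `α(n) ∈ (0,1)`. Assume that we have access to an oracle
`W` that solves `LWE_{p,Ψ_α}` given a polynomial number of samples. Then there exist a constant `c > 0` and
an efficient algorithm that, given any `n`-dimensional lattice `L`, a number `r > √2 p η_ε(L)`, and `n^c`
samples from `D_{L,r}`, solves `CVP_{L*, αp/(√2r)}`" (p. 15). Machine form, under the hypotheses of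
Theorem 3.1 as typed in A_exact (`W` a uniform family solving search-`LWE_{q,Ψ̄_α}` in the worst case with
`m(n)` samples, `α = a` rational and poly-time computable): a uniform family `R` (Lemma 3.4's procedure
— Lemmas 3.5, 3.7, 3.11 — with `W` SUBSTITUTED as a subroutine, BBBV Thm. 4.14), a batch-size
polynomial `p_N` and a negligible `ν` such that, eventually in `n`, for every nonsingular `I` of
dimension `n`, every rational `ρ > √2 q(n) η_{ε(n)}(L(I))`, every level `k` and every in-range query datum
`c` whose point `point I c` lies within `αq/(√2ρ)` of `L(I)*` and whose requested answer width is at most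
its grid exponent (`CVPOracle.Admissible`; the answer then fits on `R`'s input wires), the probability
that `R` on the canonical query string `CVPOracle.query I ρ k (encBatch b) c` does not write
`CVPOracle.answerTable I c` on its first wires, AVERAGED over the batch `b ∼ D_{L(I),ρ}^{p_N(n)}` in
integer coordinates (`Regev2009.idealBatchZ`), is at most `ν(n)` (stated in `ℝ≥0∞`). Together with
`regev2009_lemma_3_14_stepFamily` it gives A_exact (`regev2009_lemma_3_3_stepExact_of_cvp_of_step`).
Users take `(hC : regev2009_lemma_3_4_cvpFamily q α)`.
[cite: Regev2009, Lemma 3.4 (p. 15) with Lemmas 3.5, 3.7, 3.11, and the note after Lemma 3.3; BennettBernsteinBrassardVazirani1997, Thm. 4.14] -/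
def regev2009_lemma_3_4_cvpFamily : Prop :=
  ∀ (m : ℕ → ℕ) (_ : IsPolyBounded m) (_ : IsPolyTimeParams q α m)
    (_ : ∀ᶠ n : ℕ in atTop, 0 < α n ∧ α n < 1 ∧ 2 * Real.sqrt n < α n * q n)
    (_ : ∃ (W : UniformQCircuitFamily) (c : ℝ), 0 < c ∧
      W.SolvesSearchLWEWorstCase q (fun n => discretizedGaussian (q n) (α n)) m
        fun n => (2 : ℝ) ^ (-(c * n)))
    (ε : ℕ → ℝ), IsNegligible ε → (∀ n, 0 < ε n) →
    ∀ (a : ℕ → ℚ), (∀ n, α n = a n) → PolyTimeComputable unaryEncodeNat encodeRat a →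
      ∃ (R : UniformQCircuitFamily) (pN : Polynomial ℕ) (ν : ℕ → ℝ),
        IsNegligible ν ∧ (∀ n, 0 < pN.eval n) ∧
        ∀ᶠ n : ℕ in atTop, ∀ (I : LatticeInstance) (ρ : ℚ), I.n = n → I.IsNonsingular →
          Real.sqrt 2 * q n * smoothingParameter I.lattice (ε n) < ρ →
          ∀ (k : ℕ) (c : Regev2009.CVPOracle.QData I.n),
            Regev2009.CVPOracle.Admissible I (α n * q n / (Real.sqrt 2 * ρ)) c →
            ∑' b, Regev2009.idealBatchZ I (pN.eval n) ρ b *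
                ENNReal.ofReal (Regev2009.CVPOracle.failProb R I ρ k
                  (Regev2009.encBatch I.n (pN.eval n) b) c) ≤ ENNReal.ofReal (ν n)

/-- NAMED FACT (residual A_q14) — **Regev 2009, Lemma 3.14 (second part of the iterative step) in machine
form, with the oracle-substitution bound explicit.** "There exists an efficient quantum algorithm that,
given any `n`-dimensional lattice `L`, a number `d < λ₁(L*)/2`, and an oracle that solves `CVP_{L*,d}`,
outputs a sample from `D_{L,√n/(√2 d)}`" (p. 20). Machine form: for `α = a` rational and poly-time,
`q` poly-time, EVERY uniform family `R` (the candidate `CVP` solver — no promise on `R`) and all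
polynomials `p_N, L_req`, there are a uniform family `S` (the step machine of A_exact: on the copy input
`⟨⟨x, ⟨1^{k+1}, y⟩⟩, e_j⟩` it computes the level radius `ρ_k = θ(n)^{3n-k} r`, `θ = Regev2009.stepRatio a q`,
runs Lemma 3.14's sampler for `L(I)` at `d_k = αq/(√2ρ_k)` with `R` substituted for the `CVP_{L(I)*,d_k}`
oracle through the function-valued tidy block — querying `R` on the CANONICAL strings
`CVPOracle.query I ρ_k k (encBatch b) c` — and, at stages `> 3n`, copies its input vector), a code
polynomial `L ≥ L_req`, a constant `C` and a negligible `ν'` such that, eventually in `n`, for every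
nonsingular `I` of dimension `n` and rational `r`: (CODE⁺) and (PASS₁) of A_exact hold for `S` verbatim,
and (STEP) at a stage `k + 1 ≤ 3n` with `0 < ρ_k` and `d_k < λ₁(L(I)*)/2` there is a law `w` of the query
data — fixed before the batch — such that for every batch `b` of vectors with codes of length `≤ L(|x|)`,
every padding and every copy `j < p_N(n)`, the decoded output is within
`C · √(CVPOracle.weightedFail R I ρ_k k (encBatch b) d_k w) + ν'(n)` of `D_{L(I), ρ_k√n/(αq)}` in total
variation (BBBV's hybrid bound for the two oracle calls, Thm. 3.1/3.3 with Thm. 4.14; the mass of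
inadmissible queries and the errors of Lemma 3.12 / Claim 3.13 / Babai rounding inside `ν'`). Together
with `regev2009_lemma_3_4_cvpFamily` it gives A_exact. Users take `(hQ : regev2009_lemma_3_14_stepFamily q α)`.
[cite: Regev2009, Lemma 3.14 (p. 20) with Lemma 3.12, Claim 3.13, Lemma 2.5, and the proof of Lemma 3.3 (p. 15); BennettBernsteinBrassardVazirani1997, Thm. 3.1, Thm. 3.3, Thm. 4.14; BernsteinVazirani1997, §8] -/
def regev2009_lemma_3_14_stepFamily : Prop :=
  ∀ (a : ℕ → ℚ), (∀ n, α n = a n) → PolyTimeComputable unaryEncodeNat encodeRat a →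
    PolyTimeComputable unaryEncodeNat encodeNat q →
    (∀ᶠ n : ℕ in atTop, 0 < α n ∧ α n < 1 ∧ 2 * Real.sqrt n < α n * q n) →
    ∀ (R : UniformQCircuitFamily) (pN Lreq : Polynomial ℕ),
      ∃ (S : UniformQCircuitFamily) (L : Polynomial ℕ) (C : ℝ) (ν' : ℕ → ℝ),
        IsNegligible ν' ∧ (∀ t, Lreq.eval t ≤ L.eval t) ∧
        ∀ᶠ n : ℕ in atTop, ∀ (I : LatticeInstance) (r : ℚ) (x : List Bool), I.n = n → I.IsNonsingular →
          x = GapSVPInstance.encode (I, r) →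
          (∀ (k : ℕ) (y : List Bool) (j : ℕ) (s : List Bool),
            s ∈ (S.kernel (boolPair (stageInput x (k + 1) y)
              (Regev2009.StageCopies.idxWord (Regev2009.StageCopies.KOf pN x (k + 1) y) j))).support →
            boolPair (Regev2009.vecCode I.n (decodeLatticeVector I.n s)) [] <+: s ∧
              (Regev2009.vecCode I.n (decodeLatticeVector I.n s)).length ≤ L.eval x.length) ∧
          (∀ k, k < 3 * I.n →
            0 < Regev2009.levelRadius (Regev2009.stepRatio a q I.n) (3 * I.n) r k →
            α I.n * q I.n / (Real.sqrt 2 * Regev2009.levelRadius (Regev2009.stepRatio a q I.n) (3 * I.n) r k) <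
              minNorm (dualLattice I.lattice) / 2 →
            ∃ w : PMF (Regev2009.CVPOracle.QData I.n),
              ∀ b : Fin (pN.eval I.n) → Fin I.n → ℤ,
                (∀ j, (Regev2009.vecCode I.n (b j)).length ≤ L.eval x.length) →
                ∀ (pad : List Bool) (j : ℕ), j < pN.eval I.n →
                  ((S.kernel (boolPair (stageInput x (k + 1) (Regev2009.encBatch I.n (pN.eval I.n) b ++ pad))
                      (Regev2009.StageCopies.idxWord (Regev2009.StageCopies.KOf pN x (k + 1)
                        (Regev2009.encBatch I.n (pN.eval I.n) b ++ pad)) j))).map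
                      (decodeLatticeVector I.n)).tvDist
                    ((discreteGaussian I.lattice
                        (Regev2009.levelRadius (Regev2009.stepRatio a q I.n) (3 * I.n) r k * Real.sqrt I.n /
                          (α I.n * q I.n)) 0).map
                      I.intCoords) ≤
                    C * Real.sqrt (Regev2009.CVPOracle.weightedFail R I
                        (Regev2009.levelRadiusQ (Regev2009.stepRatio a q I.n) (3 * I.n) r k) k
                        (Regev2009.encBatch I.n (pN.eval I.n) b)
                        (α I.n * q I.n /
                          (Real.sqrt 2 * Regev2009.levelRadius (Regev2009.stepRatio a q I.n) (3 * I.n) r k))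
                        w).toReal + ν' I.n) ∧
          (∀ k, 3 * I.n ≤ k → ∀ b : Fin (pN.eval I.n) → Fin I.n → ℤ,
            (∀ j, (Regev2009.vecCode I.n (b j)).length ≤ L.eval x.length) →
            ∀ (pad : List Bool) (j : ℕ) (hj : j < pN.eval I.n),
              (S.kernel (boolPair (stageInput x (k + 1) (Regev2009.encBatch I.n (pN.eval I.n) b ++ pad))
                  (Regev2009.StageCopies.idxWord (Regev2009.StageCopies.KOf pN x (k + 1)
                    (Regev2009.encBatch I.n (pN.eval I.n) b ++ pad)) j))).map
                  (decodeLatticeVector I.n) = PMF.pure (b ⟨j, hj⟩))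

open Regev2009 Regev2009.CVPOracle in
/-- **A_exact from A_cvp and A_q14** — Regev's proof of Lemma 3.3 (p. 15) at the machine level: the step
family of A_exact is the family `S` of Lemma 3.14 run with the `CVP` family `R` of Lemma 3.4 substituted
for its oracle. The condition of Lemma 3.14 holds by Claim 2.13 (`decodingDist_lt_half_minNorm_dual`,
with `α < 1` and `ε(n) ≤ e^{-π}` eventually); the per-batch error is
`F₁(b) = |C| √(weightedFail(b)) + |ν'(n)|`, and `E_b[min 1 F₁(b)] ≤ |C| √(ν(n)) + |ν'(n)|` — negligible —
by exchanging the averages over the batch and over the query (`tsum_mul_weightedFail_le`) and Jensen's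
inequality for `√` (`tsum_toReal_mul_sqrt_le`). [cite: Regev2009, Lemma 3.3 (proof, p. 15), Lemmas 3.4, 3.14, Claim 2.13; BennettBernsteinBrassardVazirani1997, Thm. 3.3] -/
theorem regev2009_lemma_3_3_stepExact_of_cvp_of_step (hC : regev2009_lemma_3_4_cvpFamily q α)
    (hQ : regev2009_lemma_3_14_stepFamily q α) : regev2009_lemma_3_3_stepExact q α := by
  intro m hm hP hreg hW ε hε hεpos a hαa hac Lreq
  obtain ⟨R, pN, ν, hν, hpN, hR⟩ := hC m hm hP hreg hW ε hε hεpos a hαa hac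
  obtain ⟨hqc, -, -⟩ := hP
  obtain ⟨S, L, C, ν', hν', hLreq, hS⟩ := hQ a hαa hac hqc hreg R pN Lreq
  have hνsq : IsNegligible fun n => |C| * Real.sqrt |ν n| := (isNegligible_sqrt_abs hν).const_mul |C|
  have hν'a : IsNegligible fun n => |ν' n| :=
    Asymptotics.SuperpolynomialDecay.trans_abs_le hν' fun n => by rw [abs_abs]
  have hεπ : ∀ᶠ n : ℕ in atTop, ε n ≤ Real.exp (-Real.pi) := by
    have h0 := hε 0
    simp only [pow_zero, one_mul] at h0
    exact (h0.eventually (ge_mem_nhds (Real.exp_pos _))).mono fun n hn => hn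
  refine ⟨S, pN, L, fun n => |C| * Real.sqrt |ν n| + |ν' n|, hνsq.add hν'a, hpN, hLreq, ?_⟩
  filter_upwards [hR, hS, hreg, hεπ] with n hRn hSn hregn hεn I r x hIn hI hx
  obtain ⟨hα0, hα1, -⟩ := hregn
  obtain ⟨hcode, hstep, hpass⟩ := hSn I r x hIn hI hx
  refine ⟨hcode, fun k hk hsm => ?_, hpass⟩
  -- (STEP₁) at the stage `k + 1 ≤ 3n`
  subst hIn
  have hn : 0 < I.n := by omega
  have hq0 : (0 : ℝ) < q I.n := by exact_mod_cast Nat.pos_of_ne_zero (NeZero.ne (q I.n))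
  set θ : ℚ := stepRatio a q I.n
  set ρk : ℝ := levelRadius (θ : ℝ) (3 * I.n) (r : ℝ) k
  have hη : 0 ≤ smoothingParameter I.lattice (ε I.n) := smoothingParameter_nonneg _ _
  have hρpos : 0 < ρk := lt_of_le_of_lt (mul_nonneg (mul_nonneg (Real.sqrt_nonneg _) hq0.le) hη) hsm
  have hd : α I.n * q I.n / (Real.sqrt 2 * ρk) < minNorm (dualLattice I.lattice) / 2 :=
    decodingDist_lt_half_minNorm_dual I hI hn (hεpos _) hεn hα0 hα1 hq0 hsm
  obtain ⟨w, hw⟩ := hstep k hk hρpos hd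
  set ρQ : ℚ := levelRadiusQ θ (3 * I.n) r k
  have hcast : ((ρQ : ℚ) : ℝ) = ρk := cast_levelRadiusQ θ (3 * I.n) r k
  set d : ℝ := α I.n * q I.n / (Real.sqrt 2 * ρk)
  -- the per-batch error functional
  set G : (Fin (pN.eval I.n) → Fin I.n → ℤ) → ℝ≥0∞ :=
    fun b => weightedFail R I ρQ k (encBatch I.n (pN.eval I.n) b) d w
  refine ⟨fun b => |C| * Real.sqrt (G b).toReal + |ν' I.n|, fun b => by positivity, fun b hb pad j hj => ?_, ?_⟩
  · -- the bound of A_q14, with `C ≤ |C|`, `ν' ≤ |ν'|`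
    refine (hw b hb pad j hj).trans ?_
    exact add_le_add (mul_le_mul_of_nonneg_right (le_abs_self C) (Real.sqrt_nonneg _)) (le_abs_self _)
  · -- `E_b[min 1 F₁] ≤ |C| √ν + |ν'|`
    set p : PMF (Fin (pN.eval I.n) → Fin I.n → ℤ) := idealBatchZ I (pN.eval I.n) ρk
    have hsp : Summable fun b => (p b).toReal := ENNReal.summable_toReal p.tsum_coe_ne_top
    have hp1 : ∑' b, (p b).toReal = 1 := by
      rw [← ENNReal.tsum_toReal_eq fun b => p.apply_ne_top b, PMF.tsum_coe, ENNReal.toReal_one]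
    have hG1 : ∀ b, G b ≤ 1 := fun b => weightedFail_le_one R I ρQ k _ d w
    have hsq1 : ∀ b, Real.sqrt (G b).toReal ≤ 1 := fun b => by
      have h1 : (G b).toReal ≤ 1 := by
        have := ENNReal.toReal_mono ENNReal.one_ne_top (hG1 b)
        rwa [ENNReal.toReal_one] at this
      rw [← Real.sqrt_one]
      exact Real.sqrt_le_sqrt h1
    have hsA : Summable fun b => (p b).toReal * Real.sqrt (G b).toReal :=
      hsp.of_nonneg_of_le (fun b => mul_nonneg ENNReal.toReal_nonneg (Real.sqrt_nonneg _)) fun b => by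
        simpa using mul_le_mul_of_nonneg_left (hsq1 b) (ENNReal.toReal_nonneg (a := p b))
    have hsF : Summable fun b => (p b).toReal * (|C| * Real.sqrt (G b).toReal + |ν' I.n|) := by
      have e : (fun b => (p b).toReal * (|C| * Real.sqrt (G b).toReal + |ν' I.n|)) =
          fun b => |C| * ((p b).toReal * Real.sqrt (G b).toReal) + (p b).toReal * |ν' I.n| := by
        funext b; ring
      rw [e]
      exact (hsA.mul_left _).add (hsp.mul_right _)
    -- the averaged weighted failure is at most `|ν(n)|` (A_cvp at the rational `ρ_k`, Fubini)
    have hRc : ∀ c, Admissible I d c →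
        ∑' b, p b * ENNReal.ofReal (failProb R I ρQ k (encBatch I.n (pN.eval I.n) b) c) ≤
          ENNReal.ofReal |ν I.n| := by
      intro c hc
      have h := hRn I ρQ rfl hI (by rw [hcast]; exact hsm) k c (by rw [hcast]; exact hc)
      rw [hcast] at h
      exact h.trans (ENNReal.ofReal_le_ofReal (le_abs_self _))
    have hAvg : ∑' b, p b * G b ≤ ENNReal.ofReal |ν I.n| :=
      tsum_mul_weightedFail_le R I ρQ k (pN.eval I.n) d p w hRc
    -- Jensen for `√`
    have hJ : ∑' b, (p b).toReal * Real.sqrt (G b).toReal ≤ Real.sqrt |ν I.n| :=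
      tsum_toReal_mul_sqrt_le p G hG1 (abs_nonneg _) hAvg
    have hsM : Summable fun b => (p b).toReal * min 1 (|C| * Real.sqrt (G b).toReal + |ν' I.n|) :=
      hsp.of_nonneg_of_le (fun b => mul_nonneg ENNReal.toReal_nonneg (le_min zero_le_one (by positivity)))
        fun b => by
          simpa using mul_le_mul_of_nonneg_left
            (min_le_left (1 : ℝ) (|C| * Real.sqrt (G b).toReal + |ν' I.n|)) (ENNReal.toReal_nonneg (a := p b))
    show ∑' b, (p b).toReal * min 1 (|C| * Real.sqrt (G b).toReal + |ν' I.n|) ≤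
      |C| * Real.sqrt |ν I.n| + |ν' I.n|
    calc ∑' b, (p b).toReal * min 1 (|C| * Real.sqrt (G b).toReal + |ν' I.n|)
        ≤ ∑' b, (p b).toReal * (|C| * Real.sqrt (G b).toReal + |ν' I.n|) :=
          hsM.tsum_le_tsum (fun b => mul_le_mul_of_nonneg_left (min_le_right _ _) ENNReal.toReal_nonneg) hsF
      _ = |C| * ∑' b, (p b).toReal * Real.sqrt (G b).toReal + (∑' b, (p b).toReal) * |ν' I.n| := by
          have e : ∀ b, (p b).toReal * (|C| * Real.sqrt (G b).toReal + |ν' I.n|) =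
              |C| * ((p b).toReal * Real.sqrt (G b).toReal) + (p b).toReal * |ν' I.n| := fun b => by ring
          rw [tsum_congr e, (hsA.mul_left _).tsum_add (hsp.mul_right _), tsum_mul_left, tsum_mul_right]
      _ ≤ |C| * Real.sqrt |ν I.n| + 1 * |ν' I.n| := by
          rw [hp1]
          exact add_le_add (mul_le_mul_of_nonneg_left hJ (abs_nonneg C)) le_rfl
      _ = |C| * Real.sqrt |ν I.n| + |ν' I.n| := by rw [one_mul]

/-- **A_step from A_cvp and A_q14** (via `regev2009_lemma_3_3_stepMachine_of_exact`).
[cite: Regev2009, Lemma 3.3 (proof, p. 15), Lemmas 3.4, 3.14] -/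
theorem regev2009_lemma_3_3_stepMachine_of_cvp_of_step (hC : regev2009_lemma_3_4_cvpFamily q α)
    (hQ : regev2009_lemma_3_14_stepFamily q α) : regev2009_lemma_3_3_stepMachine q α :=
  regev2009_lemma_3_3_stepMachine_of_exact q α (regev2009_lemma_3_3_stepExact_of_cvp_of_step q α hC hQ)

/-- **`pqc.S19` as filed — Regev's Theorem 1.1, `SIVP` form — from the two residuals A_cvp (Lemma 3.4,
classical) and A_q14 (Lemma 3.14, quantum) alone**, every other step of Regev's §3 being proved in
the tree (`regev_lwe_to_sivp_quantum_holds_of_exact`). [cite: Regev2009, Theorem 1.1, Theorem 3.1, Lemma 3.3 (= Lemma 3.4 + Lemma 3.14), Lemma 3.17] -/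
theorem regev_lwe_to_sivp_quantum_holds_of_cvp_of_step (m : ℕ → ℕ)
    (hC : regev2009_lemma_3_4_cvpFamily q α) (hQ : regev2009_lemma_3_14_stepFamily q α) :
    regev_lwe_to_sivp_quantum q α m :=
  regev_lwe_to_sivp_quantum_holds_of_exact q α m (regev2009_lemma_3_3_stepExact_of_cvp_of_step q α hC hQ)

/-- **Regev's Theorem 1.1, `GapSVP` form, from A_cvp and A_q14 alone**
(`regev_lwe_to_gapSVP_quantum_holds_of_exact`). [cite: Regev2009, Theorem 1.1, Theorem 3.1, Lemma 3.3 (= Lemma 3.4 + Lemma 3.14), Lemma 3.20] -/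
theorem regev_lwe_to_gapSVP_quantum_holds_of_cvp_of_step (m : ℕ → ℕ)
    (hC : regev2009_lemma_3_4_cvpFamily q α) (hQ : regev2009_lemma_3_14_stepFamily q α) :
    regev_lwe_to_gapSVP_quantum q α m :=
  regev_lwe_to_gapSVP_quantum_holds_of_exact q α m (regev2009_lemma_3_3_stepExact_of_cvp_of_step q α hC hQ)

end Split

end Literature.Computability.Cryptography

end
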